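import Summits.BirchSwinnertonDyer.Rank1Residual.X11a.Cells
import Summits.BirchSwinnertonDyer.Rank1Residual.Additive.X4ThreeResCertKernel
import Summits.BirchSwinnertonDyer.Rank1Residual.X11b.VisibilityPrimeList
import Literature.NumberTheory.EllipticCurves.OrdinaryPrimesProofs
import Literature.NumberTheory.EllipticCurves.LFunctionPrimeCoeff
import Literature.NumberTheory.DiophantineGeometry.LocalReduction
import HarnessLib

/-!
# Class X11a — the (ram) bit from the integral model: NO (ram) prime, by a prime-list certificate
# (cell `bsd-print-x11a`, seat p4; tool for the per-pair visibility records `X11a/VisibilityRecords*`)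

HONEST FRAMING (cells `b2b-bsdres` / `bsd-print-x11a`, verbatim): the goal is to DELETE the
COMBINATION-SHAPED residual classes of the Birch–Swinnerton-Dyer formula for ALL analytic-rank
`≤ 1` elliptic curves over `ℚ` — "full BSD formula for every rank `≤ 1` curve in class `C`"
assembled STRICTLY from published theorems — so that the rank-`≤ 1` remainder becomes exactly the
CONSTRUCTION-SHAPED classes, which are TYPED (missing-input `Prop`s), NOT attempted. This is not
"finishing BSD". TOOL: one theorem, no definition, no named fact; closes nothing, books nothing.

## What

`not_ram_of_intModel` — the complement of the tree's `IntModel.ram_of_intModel` (a (ram) WITNESS from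
the integral model): for a globally minimal `W/ℚ` with integral model `E₀`, a prime `p`, and the
complete prime support `L` of `Δ(E₀)` (`|Δ(E₀)| = ∏ qᵢ^{eᵢ}`, kernel-checkable), if every `ℓ ∈ L` is
`p` itself, or ADDITIVE (`ℓ ∣ c₄(E₀)`, Silverman VII.5.1 (c); tree `Additive.addv_of_intModel`), or
has `p ∣ ord_ℓ Δ(E₀)`, then `¬ Ram W p` (`Ram W p := ∃ ℓ ≠ p` multiplicative with
`p ∤ ord_ℓ Δ_min`, `Rank1Residual/Predicates.lean`): a multiplicative `ℓ` divides `Δ_min = Δ(E₀)`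
(else good reduction, VII.5.1 (a), tree `hasGoodReductionAtPrime_of_not_dvd`, and good excludes
multiplicative, `HasGoodReductionAt.not_hasMultiplicativeReductionAt`). Used by the records
`X11a/VisibilityRecordsAtoms*.lean` to put the class atom `¬ Ram` of `ClassX11a` in the kernel.

References: [SilvermanAEC2009] VII.5 Prop. 5.1; [SkinnerUrban2014] Thm. 2 (hypothesis (ram)).
-/

set_option autoImplicit false

noncomputable section

open scoped Classical

open WeierstrassCurve Literature.NumberTheory.EllipticCurves
  Literature.NumberTheory.EllipticCurves.Rank1Residual
  NumberField IsDedekindDomain Rat.HeightOneSpectrum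
  Summit.BirchSwinnertonDyer.BirchSwinnertonDyer.Rank1Residual.IntModel

namespace Summit.BirchSwinnertonDyer.Rank1Residual.X11a.VisibilityRecords

/-- **No (ram) prime, from the integral model.** For the globally minimal `W` with integral model
`E₀`, a prime `p` and the complete prime support `L` of `Δ(E₀)` (`|Δ| = ∏ qᵢ^eᵢ`, kernel): if every
`ℓ ∈ L` is `p` itself, or additive (`ℓ ∣ c₄(E₀)`, Silverman VII.5.1 (c)), or has `p ∣ ord_ℓ Δ(E₀)`, then
`¬ Ram W p` — a multiplicative prime `ℓ ∤ Δ_min` being impossible (good reduction, VII.5.1 (a)).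
[cite: SilvermanAEC2009, VII.5 Prop. 5.1] [cite: SkinnerUrban2014, Thm. 2 (p. 3), second bullet] -/
theorem not_ram_of_intModel {W : WeierstrassCurve ℚ} [W.IsElliptic] [W.IsGloballyMinimal]
    {E₀ : WeierstrassCurve ℤ} (hI : integralModelInt W = E₀) (p : ℕ) [Fact p.Prime]
    (L es : List ℕ) (hL : ∀ q ∈ L, q.Prime)
    (hfac : (E₀.Δ).natAbs = ((L.zip es).map fun qe : ℕ × ℕ ↦ qe.1 ^ qe.2).prod)
    (hall : ∀ ℓ ∈ L, ℓ = p ∨ (ℓ : ℤ) ∣ E₀.c₄ ∨ (p : ℤ) ∣ padicValInt ℓ E₀.Δ) : ¬ Ram W p := by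
  rintro ⟨ℓ, hℓ, hne, hmult, hnv⟩
  by_cases hdvd : (ℓ : ℤ) ∣ E₀.Δ
  · rcases hall ℓ (X11b.forall_mem_of_natAbs_eq_prod_pow L es hL hfac ℓ hℓ.out hdvd) with h | h | h
    · exact hne h
    · exact (Additive.addv_of_intModel hI ℓ hdvd h).2 hmult
    · apply hnv
      rw [minimalDiscriminantInt_eq hI]
      exact_mod_cast h
  · have hgood : W.HasGoodReductionAtPrime ℓ :=
      hasGoodReductionAtPrime_of_not_dvd W ℓ (by rwa [minimalDiscriminantInt_eq hI])
    set v : HeightOneSpectrum (𝓞 ℚ) := (primesEquiv (R := 𝓞 ℚ)).symm ⟨ℓ, hℓ.out⟩ with hvdef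
    have hv : primesEquiv v = ⟨ℓ, hℓ.out⟩ := Equiv.apply_symm_apply _ _
    have key : ∀ q' : Nat.Primes, primesEquiv v = q' →
        (haveI := Fact.mk q'.2; W.HasGoodReductionAtPrime (q' : ℕ)) →
        (haveI := Fact.mk q'.2; W.HasMultiplicativeReductionAtPrime (q' : ℕ)) → False := by
      rintro q' rfl hg hm
      exact ((hasGoodReductionAtPrime_iff_hasGoodReductionAt_ringOfIntegers v W).mp hg)
        |>.not_hasMultiplicativeReductionAt
        ((hasMultiplicativeReductionAtPrime_iff_hasMultiplicativeReductionAt_ringOfIntegers W v).mp hm)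
    exact key ⟨ℓ, hℓ.out⟩ hv hgood hmult

end Summit.BirchSwinnertonDyer.Rank1Residual.X11a.VisibilityRecords

end
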